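import Mathlib
import HarnessLib
import Literature.NumberTheory.DiophantineGeometry.SquarefulSums
import Literature.NumberTheory.DiophantineGeometry.SquarefulSumsDetMethod
import Literature.NumberTheory.DiophantineGeometry.SquarefulSumsCountingTools

/-!
# Sums of three squareful numbers: the upper bound `N₁(B) ≪ B^{3/5} (log B)^{12}`

This file **discharges** the named fact
`Literature.NumberTheory.DiophantineGeometry.SquarefulSumUpperBound` of
`Literature/NumberTheory/DiophantineGeometry/SquarefulSums.lean` — **Theorem 2** of
T. D. Browning, K. Van Valckenborgh, *Sums of three squareful numbers*, Exp. Math. 21 (2012)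
204–211 [cite: BrowningValckenborgh2012, Thm. 2]: there is `C` with
`N₁(B) ≤ C B^{3/5} (log B)^{12}` for all `B ≥ 2`, where `N₁(B)` (`squarefulSumCount B`) counts
the primitive triples of positive squareful integers `x + y = z` with `x, y, z ≤ B`.
No statement of `SquarefulSums.lean` is changed and no definition is introduced.

## The printed proof (§4 of the paper) and this formalisation

Write each squareful number as `xᵢ² yᵢ³` (`exists_sq_mul_cube_of_isPowerful`; for the upper
bound any such decomposition will do, and `xᵢyᵢ` are pairwise coprime because `(x, y, z)` is an
`abc`-triple), so that `N₁(B)` is at most the number of `(x, y) ∈ ℕ⁶` with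
`x₀²y₀³ + x₁²y₁³ = x₂²y₂³ ≤ B`. Split into dyadic boxes `Xᵢ ≤ xᵢ < 2Xᵢ`, `Yᵢ ≤ yᵢ < 2Yᵢ`
(`Xᵢ = 2^{aᵢ}`, `Yᵢ = 2^{bᵢ}`, at most `(log₂ B + 1)⁶` boxes). For a box, `X²Y³ ≤ B³`
(`X = X₀X₁X₂`, `Y = Y₀Y₁Y₂`), and the equation is viewed

* as a family of **conics** in `x` (coefficients `yᵢ³`, `d = 2`): `N(X, Y) ≪ (X^{1/3} + Y L) L³`,
* as a family of **cubics** in `y` (coefficients `xᵢ²`, `d = 3`): `N(X, Y) ≪ ((XY)^{1/3} + X L) L⁶`,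

(`viewBound`, both from `SquarefulDet.fiberBound` of `SquarefulSumsDetMethod` with the counting
tools of `SquarefulSumsCountingTools`; `L ≍ log B`). Here the paper has `(X^{1/3} + Y) L³` and
`(Y^{1/3}X^{5/9} + X) L⁶` from Lemma 3: our lattice index is the full `|c₁c₂c₃|` (better main
terms), while choosing the auxiliary prime of the determinant method coprime to the coefficients
costs the additive `L` in the secondary terms. The optimisation of the paper goes through with
room `L^{4/5}` to spare (`optimise`, `boxBound`): if `Y ≤ X L³` then
`Y L⁴ ≤ (X²Y³)^{1/5} L^{26/5} ≤ B^{3/5} L⁶`, otherwise `X L⁷ < (X²Y³)^{1/5} L^{26/5}`; and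
`X^{1/3}, (XY)^{1/3} ≤ B^{1/2}`. Summing over the `≪ L⁶` boxes gives Theorem 2
(`SquarefulSumUpperBound_holds`), with an explicit (astronomical) constant depending on the
threshold beyond which `ϑ(2x) - ϑ(x) ≥ 5x/8`.

## References

* T. D. Browning, K. Van Valckenborgh, *Sums of three squareful numbers*, Exp. Math. 21 (2012)
  204–211, arXiv:1106.4472, §4 [BrowningValckenborgh2012].
* D. R. Heath-Brown, *The density of rational points on curves and surfaces*, Ann. of Math. 155
  (2002) 553–595 [Heathbrown2002].
-/

noncomputable section

namespace Literature.NumberTheory.DiophantineGeometry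

namespace SquarefulUpper

open Finset Real

/-! ### Squareful numbers are `x² y³` -/

/-- A positive squareful (`2`-powerful) number is of the form `x² y³` with `x, y ≥ 1`
(take `n = b² a` with `a` square-free; powerfulness forces `a ∣ b`). [folklore] -/
theorem exists_sq_mul_cube_of_isPowerful {a : ℕ} (ha : 0 < a) (hpow : IsPowerful 2 a) :
    ∃ x y : ℕ, 0 < x ∧ 0 < y ∧ a = x ^ 2 * y ^ 3 := by
  obtain ⟨s, b, hs0, hb0, hsb, hsq⟩ := Nat.sq_mul_squarefree_of_pos ha
  -- every prime factor of the square-free part `s` divides `b`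
  have hdvd : ∀ p ∈ s.primeFactors, p ∣ b := by
    intro p hp
    have hpp := Nat.prime_of_mem_primeFactors hp
    have hps : p ∣ s := Nat.dvd_of_mem_primeFactors hp
    have hpa : p ∈ a.primeFactors := by
      rw [Nat.mem_primeFactors]
      exact ⟨hpp, hps.trans ⟨b ^ 2, by rw [← hsb]; ring⟩, ha.ne'⟩
    have hp2 : p ^ 2 ∣ b ^ 2 * s := by rw [hsb]; exact hpow p hpa
    by_contra hpb
    have hcop : Nat.Coprime (p ^ 2) (b ^ 2) :=
      (Nat.Coprime.pow_left 2 ((Nat.Prime.coprime_iff_not_dvd hpp).mpr hpb)).pow_right 2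
    have hp2s : p ^ 2 ∣ s := hcop.dvd_of_dvd_mul_left hp2
    rw [pow_two] at hp2s
    exact hpp.one_lt.ne' (Nat.isUnit_iff.mp (hsq p hp2s))
  have hsb' : s ∣ b := by
    rw [← Nat.prod_primeFactors_of_squarefree hsq]
    exact Finset.prod_primes_dvd b (fun p hp => Nat.prime_iff.mp (Nat.prime_of_mem_primeFactors hp))
      hdvd
  obtain ⟨c, rfl⟩ := hsb'
  refine ⟨c, s, Nat.pos_of_mul_pos_left hb0, hs0, ?_⟩
  rw [← hsb]; ring

/-! ### The bound on one fibre of a "view" -/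

/-- One fibre of a view (fixed coefficient vector `v`, unknowns `u` in the box `uᵢ < 2Uᵢ`):
choose the auxiliary prime by `hprime` and apply `SquarefulDet.fiberBound`. [folklore] -/
theorem perFibreBound {n e : ℕ} (hn : 1 ≤ n) (hn6 : n + 1 ∣ 6) (A D : ℝ) (hD : 0 ≤ D)
    (hroot : ∀ m : ℕ, 0 < m →
      (Nat.card {ρ : ZMod (m ^ e) // ρ ^ (n + 1) = 1} : ℝ) ≤ A * D ^ m.primeFactors.card)
    {N₀ : ℝ} (hN₀ : 0 < N₀)
    (hprime : ∀ x : ℝ, N₀ ≤ x → ∀ m : ℕ, m ≠ 0 → Real.log m ≤ x / 2 →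
      ∃ p : ℕ, p.Prime ∧ x < p ∧ (p : ℝ) ≤ 2 * x ∧ ¬ p ∣ m)
    (B : ℕ) (U V : Fin 3 → ℕ) (hV : ∀ i, 0 < V i)
    (v : Fin 3 → ℕ) (hvV : ∀ i, V i ≤ v i) (hvB : ∀ i, v i ≤ B) (hv0 : ∀ i, 0 < v i)
    (hvc : ∀ i j, i ≠ j → (v i).Coprime (v j))
    (Gv : Finset (Fin 3 → ℕ))
    (hGv : ∀ u ∈ Gv, (∀ i, u i < 2 * U i) ∧ (∀ i j, i ≠ j → (u i).Coprime (u j)) ∧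
      (∀ i k, i ≠ k → (u i).Coprime (v k)) ∧
      (v 0 : ℤ) ^ e * (u 0 : ℤ) ^ (n + 1) + (v 1 : ℤ) ^ e * (u 1 : ℤ) ^ (n + 1)
        = (v 2 : ℤ) ^ e * (u 2 : ℤ) ^ (n + 1)) :
    (#Gv : ℝ) ≤ 12 * (n + 1) * (n + 2) * A ^ 3 *
      (N₀ + 2 * Real.log (6 * (B : ℝ) ^ 3) +
        (48 * ((U 0 : ℝ) * U 1 * U 2) / ((V 0 : ℝ) * V 1 * V 2) ^ e) ^ (1 / 3 : ℝ)) *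
      ∏ k, D ^ (v k).primeFactors.card := by
  classical
  -- Step 0: the auxiliary prime
  set m : ℕ := 6 * (v 0 * v 1 * v 2) with hm
  have hvvv : 0 < v 0 * v 1 * v 2 := Nat.mul_pos (Nat.mul_pos (hv0 0) (hv0 1)) (hv0 2)
  have hm0 : m ≠ 0 := Nat.mul_ne_zero (by norm_num) hvvv.ne'
  have hmB : (m : ℝ) ≤ 6 * (B : ℝ) ^ 3 := by
    have : v 0 * v 1 * v 2 ≤ B * B * B := Nat.mul_le_mul (Nat.mul_le_mul (hvB 0) (hvB 1)) (hvB 2)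
    calc (m : ℝ) = 6 * ((v 0 * v 1 * v 2 : ℕ) : ℝ) := by rw [hm]; push_cast; ring
      _ ≤ 6 * ((B * B * B : ℕ) : ℝ) := by gcongr
      _ = 6 * (B : ℝ) ^ 3 := by push_cast; ring
  set R : ℝ := (48 * ((U 0 : ℝ) * U 1 * U 2) / ((V 0 : ℝ) * V 1 * V 2) ^ e) ^ (1 / 3 : ℝ) with hR
  have hR0 : 0 ≤ R := Real.rpow_nonneg (by positivity) _
  set P : ℝ := max N₀ (max (2 * Real.log m) R) with hP
  have hlogm0 : 0 ≤ Real.log m := Real.log_natCast_nonneg m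
  have h2logm : 2 * Real.log m ≤ P := le_trans (le_max_left _ _) (le_max_right _ _)
  obtain ⟨p, hp, hPp, hp2P, hpm⟩ := hprime P (le_max_left _ _) m hm0 (by linarith)
  have hm6 : 6 ∣ m := Dvd.intro _ rfl
  have hp6 : ¬ p ∣ 6 := fun h => hpm (h.trans hm6)
  have hpd : ¬ p ∣ n + 1 := fun h => hp6 (h.trans hn6)
  have hvm : ∀ k, v k ∣ m := by
    intro k
    have h := Finset.dvd_prod_of_mem v (Finset.mem_univ k)
    rw [Fin.prod_univ_three] at h
    exact h.trans ⟨6, by rw [hm]; ring⟩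
  have hpv : ∀ k, ¬ p ∣ v k := fun k h => hpm (h.trans (hvm k))
  -- coefficients
  set c : Fin 3 → ℤ := ![(v 0 : ℤ) ^ e, (v 1 : ℤ) ^ e, -((v 2 : ℤ) ^ e)] with hc
  have hc0' : c 0 = (v 0 : ℤ) ^ e := rfl
  have hc1' : c 1 = (v 1 : ℤ) ^ e := rfl
  have hc2' : c 2 = -((v 2 : ℤ) ^ e) := rfl
  have hvZ : ∀ i, (v i : ℤ) ≠ 0 := fun i => by exact_mod_cast (hv0 i).ne'
  have hc0 : ∀ i, c i ≠ 0 := by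
    intro i
    fin_cases i
    · exact hc0' ▸ pow_ne_zero _ (hvZ 0)
    · exact hc1' ▸ pow_ne_zero _ (hvZ 1)
    · exact hc2' ▸ neg_ne_zero.mpr (pow_ne_zero _ (hvZ 2))
  have hcv : ∀ k, ((v k : ℤ) ^ e) ∣ c k := by
    intro k
    fin_cases k
    · exact hc0' ▸ dvd_rfl
    · exact hc1' ▸ dvd_rfl
    · exact hc2' ▸ (dvd_neg.mpr dvd_rfl)
  have hcu : ∀ i k, i ≠ k → IsCoprime (c i) (v k : ℤ) := by
    intro i k hik
    have hcop : IsCoprime ((v i : ℤ) ^ e) (v k : ℤ) :=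
      (Nat.isCoprime_iff_coprime.mpr (hvc i k hik)).pow_left
    fin_cases i
    · exact hcop
    · exact hcop
    · exact hcop.neg_left
  have hpc : ∀ i, ¬ ((p : ℤ) ∣ c i) := by
    intro i h
    have h' : (p : ℤ) ∣ (v i : ℤ) ^ e := by
      fin_cases i
      · exact h
      · exact h
      · exact dvd_neg.mp h
    rw [← Nat.cast_pow, Int.natCast_dvd_natCast] at h'
    exact hpv i (hp.dvd_of_dvd_pow h')
  -- size of the box against the lattice index
  set Z : Fin 3 → ℕ := fun i => 2 * U i with hZ
  have hVpos : (0 : ℝ) < (V 0 : ℝ) * V 1 * V 2 := by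
    have := hV 0; have := hV 1; have := hV 2; positivity
  have hsize : 6 * (Z 0 * Z 1 * Z 2) < (v 0 * v 1 * v 2) ^ e * p ^ 3 := by
    have h1 : 6 * (Z 0 * Z 1 * Z 2) = 48 * (U 0 * U 1 * U 2) := by simp only [hZ]; ring
    rw [h1]
    have hRP : R < p := lt_of_le_of_lt (le_trans (le_max_right _ _) (le_max_right _ _)) hPp
    have hR3 : R ^ 3 = 48 * ((U 0 : ℝ) * U 1 * U 2) / ((V 0 : ℝ) * V 1 * V 2) ^ e := by
      rw [hR, ← Real.rpow_natCast, ← Real.rpow_mul (by positivity)]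
      norm_num
    have h2 : 48 * ((U 0 : ℝ) * U 1 * U 2) < ((V 0 : ℝ) * V 1 * V 2) ^ e * (p : ℝ) ^ 3 := by
      have : R ^ 3 < (p : ℝ) ^ 3 := pow_lt_pow_left₀ hRP hR0 (by norm_num)
      rw [hR3, div_lt_iff₀ (by positivity)] at this
      linarith
    have h3 : ((V 0 : ℝ) * V 1 * V 2) ^ e * (p : ℝ) ^ 3
        ≤ ((v 0 : ℝ) * v 1 * v 2) ^ e * (p : ℝ) ^ 3 := by
      have h01 : (V 0 : ℝ) ≤ v 0 := by exact_mod_cast hvV 0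
      have h11 : (V 1 : ℝ) ≤ v 1 := by exact_mod_cast hvV 1
      have h21 : (V 2 : ℝ) ≤ v 2 := by exact_mod_cast hvV 2
      gcongr
    have h4 : (48 * ((U 0 : ℝ) * U 1 * U 2)) < ((v 0 : ℝ) * v 1 * v 2) ^ e * (p : ℝ) ^ 3 :=
      h2.trans_le h3
    exact_mod_cast h4
  -- the fibre bound over `ℤ`
  have hfb := SquarefulDet.fiberBound hn v hv0 hvc c hc0 hcv hcu hp hpd hpc hpv Z hsize
  -- inject `Gv` into the set of integer solutions
  have hinj : #Gv ≤ #((Fintype.piFinset fun i => Finset.Icc (-(Z i : ℤ)) (Z i)).filter fun u =>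
      (∀ i j, i ≠ j → IsCoprime (u i) (u j)) ∧ (∀ i k, i ≠ k → IsCoprime (u i) (v k : ℤ)) ∧
      ∑ i, c i * u i ^ (n + 1) = 0) := by
    refine Finset.card_le_card_of_injOn (fun u i => (u i : ℤ)) (fun u hu => ?_) (fun u _ u' _ h => ?_)
    · obtain ⟨hub, hucop, huv, hueq⟩ := hGv u hu
      simp only [Finset.coe_filter, Fintype.mem_piFinset, Finset.mem_Icc, Set.mem_setOf_eq]
      refine ⟨fun i => ⟨by linarith [(u i).cast_nonneg (α := ℤ)], ?_⟩, fun i j hij =>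
        Nat.isCoprime_iff_coprime.mpr (hucop i j hij), fun i k hik =>
        Nat.isCoprime_iff_coprime.mpr (huv i k hik), ?_⟩
      · simp only [hZ]; have := hub i; push_cast; exact_mod_cast (hub i).le
      · simp only [Fin.sum_univ_three, hc0', hc1', hc2']
        linear_combination hueq
    · funext i
      have hi : (u i : ℤ) = u' i := congrFun h i
      exact_mod_cast hi
  -- numerical assembly
  have hprod : (∏ k, (Nat.card {ρ : ZMod (v k ^ e) // ρ ^ (n + 1) = 1} : ℝ))
      ≤ A ^ 3 * ∏ k, D ^ (v k).primeFactors.card := by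
    rw [show A ^ 3 = ∏ _k : Fin 3, A by simp, ← Finset.prod_mul_distrib]
    exact Finset.prod_le_prod (fun k _ => by positivity) (fun k _ => hroot (v k) (hv0 k))
  have hpP : (p : ℝ) ≤ 2 * (N₀ + 2 * Real.log (6 * (B : ℝ) ^ 3) + R) := by
    have hlog : Real.log m ≤ Real.log (6 * (B : ℝ) ^ 3) :=
      Real.log_le_log (by exact_mod_cast Nat.pos_of_ne_zero hm0) hmB
    have hPle : P ≤ N₀ + 2 * Real.log m + R := by
      rw [hP]
      refine max_le (by linarith) (max_le (by linarith) (by linarith))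
    linarith
  have hDprod : 0 ≤ ∏ k, D ^ (v k).primeFactors.card := Finset.prod_nonneg fun k _ => by positivity
  have hlog6 : 0 ≤ Real.log (6 * (B : ℝ) ^ 3) := by
    have : (6 * (B : ℝ) ^ 3) = ((6 * B ^ 3 : ℕ) : ℝ) := by push_cast; ring
    rw [this]; exact Real.log_natCast_nonneg _
  have hcoef : 0 ≤ 6 * ((n : ℝ) + 1) * (n + 2) * (2 * (N₀ + 2 * Real.log (6 * (B : ℝ) ^ 3) + R)) :=
    mul_nonneg (by positivity) (mul_nonneg zero_le_two
      (add_nonneg (add_nonneg hN₀.le (mul_nonneg zero_le_two hlog6)) hR0))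
  calc (#Gv : ℝ) ≤ #((Fintype.piFinset fun i => Finset.Icc (-(Z i : ℤ)) (Z i)).filter fun u =>
        (∀ i j, i ≠ j → IsCoprime (u i) (u j)) ∧ (∀ i k, i ≠ k → IsCoprime (u i) (v k : ℤ)) ∧
        ∑ i, c i * u i ^ (n + 1) = 0) := by exact_mod_cast hinj
    _ ≤ ((2 * (n + 2) * (3 * ((n + 1) * p)) *
          ∏ k, Nat.card {ρ : ZMod (v k ^ e) // ρ ^ (n + 1) = 1} : ℕ) : ℝ) := by exact_mod_cast hfb
    _ = 6 * (n + 1) * (n + 2) * (p : ℝ) *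
          ∏ k, (Nat.card {ρ : ZMod (v k ^ e) // ρ ^ (n + 1) = 1} : ℝ) := by push_cast; ring
    _ ≤ 6 * (n + 1) * (n + 2) * (2 * (N₀ + 2 * Real.log (6 * (B : ℝ) ^ 3) + R)) *
          (A ^ 3 * ∏ k, D ^ (v k).primeFactors.card) :=
        mul_le_mul (mul_le_mul_of_nonneg_left hpP (by positivity)) hprod
          (Finset.prod_nonneg fun k _ => by positivity) hcoef
    _ = _ := by rw [hR]; ring

/-! ### The bound for one view of a dyadic box -/

/-- Summing `perFibreBound` over the coefficient vectors `v` of a dyadic box, with the divisor-sum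
bound `hdiv` for `∑ D^{ω}`. [folklore] -/
theorem viewBound {n e t : ℕ} (hn : 1 ≤ n) (hn6 : n + 1 ∣ 6) (A D : ℝ) (hD : 0 ≤ D)
    (hroot : ∀ m : ℕ, 0 < m →
      (Nat.card {ρ : ZMod (m ^ e) // ρ ^ (n + 1) = 1} : ℝ) ≤ A * D ^ m.primeFactors.card)
    (hdiv : ∀ N : ℕ, ∑ w ∈ Finset.Icc 1 N, D ^ w.primeFactors.card ≤ N * (1 + Real.log N) ^ t)
    {N₀ : ℝ} (hN₀ : 0 < N₀)
    (hprime : ∀ x : ℝ, N₀ ≤ x → ∀ m : ℕ, m ≠ 0 → Real.log m ≤ x / 2 →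
      ∃ p : ℕ, p.Prime ∧ x < p ∧ (p : ℝ) ≤ 2 * x ∧ ¬ p ∣ m)
    (B : ℕ) (U V : Fin 3 → ℕ) (hV : ∀ i, 0 < V i) (hVB : ∀ i, V i ≤ B)
    (G : Finset ((Fin 3 → ℕ) × (Fin 3 → ℕ)))
    (hG : ∀ q ∈ G, (∀ i, q.1 i < 2 * U i) ∧ (∀ i, V i ≤ q.2 i ∧ q.2 i < 2 * V i) ∧
      (∀ i, q.2 i ≤ B) ∧ (∀ i j, i ≠ j → Nat.Coprime (q.1 i * q.2 i) (q.1 j * q.2 j)) ∧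
      (q.2 0 : ℤ) ^ e * (q.1 0 : ℤ) ^ (n + 1) + (q.2 1 : ℤ) ^ e * (q.1 1 : ℤ) ^ (n + 1)
        = (q.2 2 : ℤ) ^ e * (q.1 2 : ℤ) ^ (n + 1)) :
    (#G : ℝ) ≤ 96 * (n + 1) * (n + 2) * A ^ 3 *
      (N₀ + 2 * Real.log (6 * (B : ℝ) ^ 3) +
        (48 * ((U 0 : ℝ) * U 1 * U 2) / ((V 0 : ℝ) * V 1 * V 2) ^ e) ^ (1 / 3 : ℝ)) *
      (((V 0 : ℝ) * V 1 * V 2) * (1 + Real.log (2 * B)) ^ (3 * t)) := by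
  classical
  set Vbox := Fintype.piFinset fun i : Fin 3 => Finset.Ico (V i) (2 * V i) with hVbox
  have hmaps : ∀ q ∈ G, q.2 ∈ Vbox := fun q hq =>
    Fintype.mem_piFinset.2 fun i => Finset.mem_Ico.2 ((hG q hq).2.1 i)
  have hcard : #G = ∑ v ∈ Vbox, #{q ∈ G | q.2 = v} := Finset.card_eq_sum_card_fiberwise hmaps
  set R : ℝ := (48 * ((U 0 : ℝ) * U 1 * U 2) / ((V 0 : ℝ) * V 1 * V 2) ^ e) ^ (1 / 3 : ℝ) with hR
  have hR0 : 0 ≤ R := Real.rpow_nonneg (by positivity) _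
  have hlog6 : 0 ≤ Real.log (6 * (B : ℝ) ^ 3) := by
    have : (6 * (B : ℝ) ^ 3) = ((6 * B ^ 3 : ℕ) : ℝ) := by push_cast; ring
    rw [this]; exact Real.log_natCast_nonneg _
  have hA3 : 0 ≤ A ^ 3 := by
    have h1 := hroot 1 one_pos
    simp only [Nat.primeFactors_one, Finset.card_empty, pow_zero, mul_one] at h1
    exact pow_nonneg ((Nat.cast_nonneg _).trans h1) 3
  set Kc : ℝ := 12 * (n + 1) * (n + 2) * A ^ 3 * (N₀ + 2 * Real.log (6 * (B : ℝ) ^ 3) + R)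
    with hKc
  have hKc0 : 0 ≤ Kc := by
    rw [hKc]
    exact mul_nonneg (mul_nonneg (by positivity) hA3)
      (add_nonneg (add_nonneg hN₀.le (mul_nonneg zero_le_two hlog6)) hR0)
  have hper : ∀ v ∈ Vbox, (#{q ∈ G | q.2 = v} : ℝ) ≤ Kc * ∏ k, D ^ (v k).primeFactors.card := by
    intro v hv
    rcases ({q ∈ G | q.2 = v} : Finset _).eq_empty_or_nonempty with h0 | ⟨q₀, hq₀⟩
    · rw [h0, Finset.card_empty, Nat.cast_zero]
      exact mul_nonneg hKc0 (Finset.prod_nonneg fun k _ => by positivity)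
    · rw [Finset.mem_filter] at hq₀
      obtain ⟨-, hbox2, hB2, hcop, -⟩ := hG q₀ hq₀.1
      rw [hq₀.2] at hbox2 hB2 hcop
      have hvV : ∀ i, V i ≤ v i := fun i => (hbox2 i).1
      have hv0 : ∀ i, 0 < v i := fun i => lt_of_lt_of_le (hV i) (hvV i)
      have hvc : ∀ i j, i ≠ j → (v i).Coprime (v j) := fun i j hij =>
        ((hcop i j hij).coprime_dvd_left (dvd_mul_left _ _)).coprime_dvd_right (dvd_mul_left _ _)
      have hinj : Set.InjOn Prod.fst
          ((G.filter fun q => q.2 = v : Finset ((Fin 3 → ℕ) × (Fin 3 → ℕ))) :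
            Set ((Fin 3 → ℕ) × (Fin 3 → ℕ))) := by
        intro q hq q' hq' h
        rw [Finset.coe_filter, Set.mem_setOf_eq] at hq hq'
        exact Prod.ext h (hq.2.trans hq'.2.symm)
      rw [← Finset.card_image_of_injOn hinj, hKc, hR]
      refine perFibreBound hn hn6 A D hD hroot hN₀ hprime B U V hV v hvV hB2 hv0 hvc _ ?_
      intro u hu
      obtain ⟨q, hq, rfl⟩ := Finset.mem_image.1 hu
      rw [Finset.mem_filter] at hq
      obtain ⟨hb1, -, -, hcopq, heq⟩ := hG q hq.1
      rw [hq.2] at hcopq heq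
      exact ⟨hb1, fun i j hij =>
        ((hcopq i j hij).coprime_dvd_left (dvd_mul_right _ _)).coprime_dvd_right (dvd_mul_right _ _),
        fun i k hik =>
        ((hcopq i k hik).coprime_dvd_left (dvd_mul_right _ _)).coprime_dvd_right (dvd_mul_left _ _),
        heq⟩
  -- one-dimensional sums
  have hone : ∀ k : Fin 3, ∑ w ∈ Finset.Ico (V k) (2 * V k), D ^ w.primeFactors.card
      ≤ 2 * (V k : ℝ) * (1 + Real.log (2 * B)) ^ t := by
    intro k
    have hsub : Finset.Ico (V k) (2 * V k) ⊆ Finset.Icc 1 (2 * V k) := by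
      intro w hw
      rw [Finset.mem_Ico] at hw
      rw [Finset.mem_Icc]
      have := hV k
      omega
    calc ∑ w ∈ Finset.Ico (V k) (2 * V k), D ^ w.primeFactors.card
        ≤ ∑ w ∈ Finset.Icc 1 (2 * V k), D ^ w.primeFactors.card :=
          Finset.sum_le_sum_of_subset_of_nonneg hsub fun _ _ _ => by positivity
      _ ≤ ((2 * V k : ℕ) : ℝ) * (1 + Real.log ((2 * V k : ℕ) : ℝ)) ^ t := hdiv _
      _ ≤ 2 * (V k : ℝ) * (1 + Real.log (2 * B)) ^ t := by
          push_cast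
          have h1 : (0 : ℝ) ≤ 1 + Real.log (2 * (V k : ℝ)) := by
            have : (1 : ℝ) ≤ 2 * (V k : ℝ) := by
              have := hV k
              have : (1 : ℝ) ≤ V k := by exact_mod_cast this
              linarith
            have := Real.log_nonneg this
            linarith
          have h2 : 1 + Real.log (2 * (V k : ℝ)) ≤ 1 + Real.log (2 * B) := by
            have hVk : (0 : ℝ) < V k := by exact_mod_cast hV k
            have := Real.log_le_log (by positivity) (by
              have : (V k : ℝ) ≤ B := by exact_mod_cast hVB k
              linarith : 2 * (V k : ℝ) ≤ 2 * B)
            linarith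
          gcongr
  calc (#G : ℝ) = ∑ v ∈ Vbox, (#{q ∈ G | q.2 = v} : ℝ) := by rw [hcard]; push_cast; rfl
    _ ≤ ∑ v ∈ Vbox, Kc * ∏ k, D ^ (v k).primeFactors.card := Finset.sum_le_sum hper
    _ = Kc * ∑ v ∈ Vbox, ∏ k, D ^ (v k).primeFactors.card := by rw [Finset.mul_sum]
    _ = Kc * ∏ k : Fin 3, ∑ w ∈ Finset.Ico (V k) (2 * V k), D ^ w.primeFactors.card := by
        congr 1
        rw [Finset.prod_univ_sum, hVbox]
    _ ≤ Kc * ∏ k : Fin 3, (2 * (V k : ℝ) * (1 + Real.log (2 * B)) ^ t) := by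
        refine mul_le_mul_of_nonneg_left (Finset.prod_le_prod (fun k _ => ?_) (fun k _ => hone k)) hKc0
        exact Finset.sum_nonneg fun _ _ => by positivity
    _ = Kc * (8 * ((V 0 : ℝ) * V 1 * V 2) * (1 + Real.log (2 * B)) ^ (3 * t)) := by
        rw [Fin.prod_univ_three]; ring
    _ = _ := by rw [hKc, hR]; ring

/-! ### The optimisation over the two views -/

/-- The elementary optimisation at the end of §4 of the paper: with `β⁵ = B³` (`β = B^{3/5}`),
`X²Y³ ≤ B³`, the conic bound `N ≤ K₁ (Λ + r) Y Λ³` (`r³Y³ = 48X`) and the cubic bound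
`N ≤ K₂ (Λ + s) X Λ⁶` (`s³X² = 48Y`) give `N ≤ 5 (K₁ + K₂) β Λ⁶`. [folklore] -/
theorem optimise {N X Y Λ β Bc K₁ K₂ r s : ℝ} (hX : 1 ≤ X) (hY : 1 ≤ Y) (hΛ : 1 ≤ Λ)
    (hβ : 1 ≤ β) (hβ5 : β ^ 5 = Bc ^ 3) (hβ6 : Bc ^ 3 ≤ β ^ 6) (hK₁ : 0 ≤ K₁) (hK₂ : 0 ≤ K₂)
    (hXY : X ^ 2 * Y ^ 3 ≤ Bc ^ 3) (hr3 : r ^ 3 * Y ^ 3 = 48 * X) (hs3 : s ^ 3 * X ^ 2 = 48 * Y)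
    (h1 : N ≤ K₁ * (Λ + r) * (Y * Λ ^ 3)) (h2 : N ≤ K₂ * (Λ + s) * (X * Λ ^ 6)) :
    N ≤ 5 * (K₁ + K₂) * β * Λ ^ 6 := by
  have hβ0 : 0 ≤ β := by linarith
  have hX0 : 0 ≤ X := by linarith
  have hY0 : 0 ≤ Y := by linarith
  have hΛ0 : 0 ≤ Λ := by linarith
  have hXβ : X ≤ β ^ 3 := by
    refine le_of_pow_le_pow_left₀ two_ne_zero (by positivity) ?_
    calc X ^ 2 = X ^ 2 * 1 := (mul_one _).symm
      _ ≤ X ^ 2 * Y ^ 3 := by gcongr; exact one_le_pow₀ hY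
      _ ≤ Bc ^ 3 := hXY
      _ ≤ β ^ 6 := hβ6
      _ = (β ^ 3) ^ 2 := by ring
  have hXYβ : X * Y ≤ β ^ 3 := by
    refine le_of_pow_le_pow_left₀ two_ne_zero (by positivity) ?_
    calc (X * Y) ^ 2 = X ^ 2 * Y ^ 2 * 1 := by ring
      _ ≤ X ^ 2 * Y ^ 2 * Y := by gcongr
      _ = X ^ 2 * Y ^ 3 := by ring
      _ ≤ Bc ^ 3 := hXY
      _ ≤ β ^ 6 := hβ6
      _ = (β ^ 3) ^ 2 := by ring
  have hrY : r * Y ≤ 4 * β := by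
    refine le_of_pow_le_pow_left₀ (by norm_num : (3 : ℕ) ≠ 0) (by positivity) ?_
    calc (r * Y) ^ 3 = r ^ 3 * Y ^ 3 := by ring
      _ = 48 * X := hr3
      _ ≤ 48 * β ^ 3 := by gcongr
      _ ≤ (4 * β) ^ 3 := by nlinarith [pow_nonneg hβ0 3]
  have hsX : s * X ≤ 4 * β := by
    refine le_of_pow_le_pow_left₀ (by norm_num : (3 : ℕ) ≠ 0) (by positivity) ?_
    calc (s * X) ^ 3 = s ^ 3 * X ^ 2 * X := by ring
      _ = 48 * Y * X := by rw [hs3]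
      _ = 48 * (X * Y) := by ring
      _ ≤ 48 * β ^ 3 := by gcongr
      _ ≤ (4 * β) ^ 3 := by nlinarith [pow_nonneg hβ0 3]
  have hΛ36 : Λ ^ 3 ≤ Λ ^ 6 := pow_le_pow_right₀ hΛ (by norm_num)
  rcases le_or_gt Y (X * Λ ^ 3) with hc | hc
  · -- conic view
    have hY5 : Y ^ 5 ≤ β ^ 5 * Λ ^ 6 := by
      calc Y ^ 5 = Y ^ 2 * Y ^ 3 := by ring
        _ ≤ (X * Λ ^ 3) ^ 2 * Y ^ 3 := by gcongr
        _ = X ^ 2 * Y ^ 3 * Λ ^ 6 := by ring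
        _ ≤ Bc ^ 3 * Λ ^ 6 := by gcongr
        _ = β ^ 5 * Λ ^ 6 := by rw [hβ5]
    have hYΛ : Y * Λ ^ 4 ≤ β * Λ ^ 6 := by
      refine le_of_pow_le_pow_left₀ (by norm_num : (5 : ℕ) ≠ 0) (by positivity) ?_
      calc (Y * Λ ^ 4) ^ 5 = Y ^ 5 * Λ ^ 20 := by ring
        _ ≤ β ^ 5 * Λ ^ 6 * Λ ^ 20 := by gcongr
        _ = β ^ 5 * Λ ^ 26 := by ring
        _ ≤ β ^ 5 * Λ ^ 30 := by gcongr; norm_num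
        _ = (β * Λ ^ 6) ^ 5 := by ring
    calc N ≤ K₁ * (Λ + r) * (Y * Λ ^ 3) := h1
      _ = K₁ * (Y * Λ ^ 4 + r * Y * Λ ^ 3) := by ring
      _ ≤ K₁ * (β * Λ ^ 6 + 4 * β * Λ ^ 6) := by
          gcongr K₁ * (?_ + ?_)
          calc r * Y * Λ ^ 3 ≤ 4 * β * Λ ^ 3 := by gcongr
            _ ≤ 4 * β * Λ ^ 6 := by gcongr
      _ = 5 * K₁ * β * Λ ^ 6 := by ring
      _ ≤ 5 * (K₁ + K₂) * β * Λ ^ 6 := by gcongr; linarith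
  · -- cubic view
    have hXΛ : X * Λ ^ 7 ≤ β * Λ ^ 6 := by
      refine le_of_pow_le_pow_left₀ (by norm_num : (5 : ℕ) ≠ 0) (by positivity) ?_
      calc (X * Λ ^ 7) ^ 5 = X ^ 2 * (X * Λ ^ 3) ^ 3 * Λ ^ 26 := by ring
        _ ≤ X ^ 2 * Y ^ 3 * Λ ^ 26 := by gcongr
        _ ≤ Bc ^ 3 * Λ ^ 26 := by gcongr
        _ = β ^ 5 * Λ ^ 26 := by rw [hβ5]
        _ ≤ β ^ 5 * Λ ^ 30 := by gcongr; norm_num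
        _ = (β * Λ ^ 6) ^ 5 := by ring
    calc N ≤ K₂ * (Λ + s) * (X * Λ ^ 6) := h2
      _ = K₂ * (X * Λ ^ 7 + s * X * Λ ^ 6) := by ring
      _ ≤ K₂ * (β * Λ ^ 6 + 4 * β * Λ ^ 6) := by
          gcongr K₂ * (?_ + ?_)
          gcongr
      _ = 5 * K₂ * β * Λ ^ 6 := by ring
      _ ≤ 5 * (K₁ + K₂) * β * Λ ^ 6 := by gcongr; linarith

/-! ### The bound for a dyadic box -/

/-- **`N(X, Y) ≪ B^{3/5} Λ⁶`** for the solutions of `x₀²y₀³ + x₁²y₁³ = x₂²y₂³` in the dyadic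
box `Xᵢ ≤ xᵢ < 2Xᵢ`, `Yᵢ ≤ yᵢ < 2Yᵢ` (`xᵢyᵢ` pairwise coprime, `x₂²y₂³ ≤ B`): the minimum of
the conic view (`d = 2`) and the cubic view (`d = 3`) of `viewBound`, optimised as in §4 of the
paper; here `β⁵ = B³` and `Λ` dominates the logarithms. [cite: BrowningValckenborgh2012, §4] -/
theorem boxBound {N₀ : ℝ} (hN₀ : 0 < N₀)
    (hprime : ∀ x : ℝ, N₀ ≤ x → ∀ m : ℕ, m ≠ 0 → Real.log m ≤ x / 2 →
      ∃ p : ℕ, p.Prime ∧ x < p ∧ (p : ℝ) ≤ 2 * x ∧ ¬ p ∣ m)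
    (B : ℕ) (X Y : Fin 3 → ℕ) (hX : ∀ i, 0 < X i) (hY : ∀ i, 0 < Y i)
    (hXB : ∀ i, X i ≤ B) (hYB : ∀ i, Y i ≤ B) (Λ β : ℝ) (hΛ1 : 1 ≤ Λ)
    (hΛa : N₀ + 2 * Real.log (6 * (B : ℝ) ^ 3) ≤ Λ) (hΛb : 1 + Real.log (2 * B) ≤ Λ)
    (hβ : 1 ≤ β) (hβ5 : β ^ 5 = (B : ℝ) ^ 3) (hβ6 : (B : ℝ) ^ 3 ≤ β ^ 6)
    (G : Finset ((Fin 3 → ℕ) × (Fin 3 → ℕ)))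
    (hG : ∀ q ∈ G, (∀ i, X i ≤ q.1 i ∧ q.1 i < 2 * X i) ∧ (∀ i, Y i ≤ q.2 i ∧ q.2 i < 2 * Y i) ∧
      (∀ i, q.1 i ≤ B) ∧ (∀ i, q.2 i ≤ B) ∧
      (∀ i j, i ≠ j → Nat.Coprime (q.1 i * q.2 i) (q.1 j * q.2 j)) ∧
      (q.2 0 : ℤ) ^ 3 * (q.1 0 : ℤ) ^ 2 + (q.2 1 : ℤ) ^ 3 * (q.1 1 : ℤ) ^ 2
        = (q.2 2 : ℤ) ^ 3 * (q.1 2 : ℤ) ^ 2 ∧ q.1 2 ^ 2 * q.2 2 ^ 3 ≤ B) :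
    (#G : ℝ) ≤ 28800 * β * Λ ^ 6 := by
  classical
  rcases G.eq_empty_or_nonempty with h0 | ⟨q₀, hq₀⟩
  · rw [h0, Finset.card_empty, Nat.cast_zero]; positivity
  have hB1 : 1 ≤ B := le_trans (hY 0) (hYB 0)
  set Xp : ℝ := (X 0 : ℝ) * X 1 * X 2 with hXp
  set Yp : ℝ := (Y 0 : ℝ) * Y 1 * Y 2 with hYp
  have hX1 : ∀ i, (1 : ℝ) ≤ X i := fun i => by exact_mod_cast hX i
  have hY1 : ∀ i, (1 : ℝ) ≤ Y i := fun i => by exact_mod_cast hY i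
  have hXp1 : 1 ≤ Xp := by
    have := hX1 0; have := hX1 1; have := hX1 2
    calc (1 : ℝ) = 1 * 1 * 1 := by ring
      _ ≤ Xp := by rw [hXp]; gcongr
  have hYp1 : 1 ≤ Yp := by
    have := hY1 0; have := hY1 1; have := hY1 2
    calc (1 : ℝ) = 1 * 1 * 1 := by ring
      _ ≤ Yp := by rw [hYp]; gcongr
  have hXp0 : 0 < Xp := by linarith
  have hYp0 : 0 < Yp := by linarith
  -- the box constraint `X²Y³ ≤ B³`
  have hXY : Xp ^ 2 * Yp ^ 3 ≤ (B : ℝ) ^ 3 := by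
    obtain ⟨hx, hy, -, -, -, heq, hle⟩ := hG q₀ hq₀
    have heqN : q₀.2 0 ^ 3 * q₀.1 0 ^ 2 + q₀.2 1 ^ 3 * q₀.1 1 ^ 2 = q₀.2 2 ^ 3 * q₀.1 2 ^ 2 := by
      exact_mod_cast heq
    have hb : ∀ i, X i ^ 2 * Y i ^ 3 ≤ q₀.2 i ^ 3 * q₀.1 i ^ 2 := fun i => by
      rw [mul_comm]
      exact Nat.mul_le_mul (Nat.pow_le_pow_left (hy i).1 3) (Nat.pow_le_pow_left (hx i).1 2)
    have hle' : q₀.2 2 ^ 3 * q₀.1 2 ^ 2 ≤ B := by rwa [mul_comm] at hle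
    have hb0 := hb 0
    have hb1 := hb 1
    have hb2 := hb 2
    have h0' : X 0 ^ 2 * Y 0 ^ 3 ≤ B := by omega
    have h1' : X 1 ^ 2 * Y 1 ^ 3 ≤ B := by omega
    have h2' : X 2 ^ 2 * Y 2 ^ 3 ≤ B := by omega
    have hprod : X 0 ^ 2 * Y 0 ^ 3 * (X 1 ^ 2 * Y 1 ^ 3) * (X 2 ^ 2 * Y 2 ^ 3) ≤ B * B * B :=
      Nat.mul_le_mul (Nat.mul_le_mul h0' h1') h2'
    have hcast : Xp ^ 2 * Yp ^ 3
        = ((X 0 ^ 2 * Y 0 ^ 3 * (X 1 ^ 2 * Y 1 ^ 3) * (X 2 ^ 2 * Y 2 ^ 3) : ℕ) : ℝ) := by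
      rw [hXp, hYp]; push_cast; ring
    rw [hcast]
    calc ((X 0 ^ 2 * Y 0 ^ 3 * (X 1 ^ 2 * Y 1 ^ 3) * (X 2 ^ 2 * Y 2 ^ 3) : ℕ) : ℝ)
        ≤ ((B * B * B : ℕ) : ℝ) := by exact_mod_cast hprod
      _ = (B : ℝ) ^ 3 := by push_cast; ring
  have hlog2B : 0 ≤ 1 + Real.log (2 * (B : ℝ)) := by
    have : (1 : ℝ) ≤ 2 * B := by
      have : (1 : ℝ) ≤ B := by exact_mod_cast hB1
      linarith
    have := Real.log_nonneg this
    linarith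
  -- the conic view: `d = 2`, coefficients `y³`
  have hroot2 : ∀ m : ℕ, 0 < m →
      (Nat.card {ρ : ZMod (m ^ 3) // ρ ^ (1 + 1) = 1} : ℝ) ≤ 2 * 2 ^ m.primeFactors.card := by
    intro m hm
    have h := SquarefulCount.natCard_sqrtOne_le (m ^ 3) (by positivity)
    rw [Nat.primeFactors_pow m three_ne_zero] at h
    exact_mod_cast h
  have hdiv2 : ∀ N : ℕ, ∑ w ∈ Finset.Icc 1 N, (2 : ℝ) ^ w.primeFactors.card
      ≤ N * (1 + Real.log N) ^ 1 := fun N => by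
    rw [pow_one]; exact SquarefulCount.sum_two_pow_omega_le N
  have hconic := viewBound (n := 1) (e := 3) (t := 1) le_rfl (by norm_num) 2 2 zero_le_two
    hroot2 hdiv2 hN₀ hprime B X Y hY hYB G (fun q hq => by
      obtain ⟨hx, hy, -, hyB, hcop, heq, -⟩ := hG q hq
      exact ⟨fun i => (hx i).2, hy, hyB, hcop, heq⟩)
  set r : ℝ := (48 * Xp / Yp ^ 3) ^ (1 / 3 : ℝ) with hr
  have hr3 : r ^ 3 * Yp ^ 3 = 48 * Xp := by
    have : r ^ 3 = 48 * Xp / Yp ^ 3 := by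
      rw [hr, ← Real.rpow_natCast, ← Real.rpow_mul (by positivity)]; norm_num
    rw [this, div_mul_cancel₀ _ (by positivity)]
  have h1 : (#G : ℝ) ≤ 4608 * (Λ + r) * (Yp * Λ ^ 3) := by
    refine hconic.trans ?_
    have hfac : (96 : ℝ) * (((1 : ℕ) : ℝ) + 1) * (((1 : ℕ) : ℝ) + 2) * (2 : ℝ) ^ 3 = 4608 := by
      norm_num
    rw [hfac]
    have hr0 : 0 ≤ r := Real.rpow_nonneg (by positivity) _
    have hΛr : N₀ + 2 * Real.log (6 * (B : ℝ) ^ 3) + r ≤ Λ + r := by linarith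
    have hpos : 0 ≤ N₀ + 2 * Real.log (6 * (B : ℝ) ^ 3) + r := by
      have : (6 * (B : ℝ) ^ 3) = ((6 * B ^ 3 : ℕ) : ℝ) := by push_cast; ring
      have hl : 0 ≤ Real.log (6 * (B : ℝ) ^ 3) := by rw [this]; exact Real.log_natCast_nonneg _
      linarith
    have hpow : (1 + Real.log (2 * (B : ℝ))) ^ (3 * 1) ≤ Λ ^ 3 := by
      rw [mul_one]; exact pow_le_pow_left₀ hlog2B hΛb 3
    exact mul_le_mul (mul_le_mul_of_nonneg_left hΛr (by norm_num))
      (mul_le_mul_of_nonneg_left hpow hYp0.le) (by positivity) (by positivity)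
  -- the cubic view: `d = 3`, coefficients `x²`, on the swapped pairs
  have hroot3 : ∀ m : ℕ, 0 < m →
      (Nat.card {ρ : ZMod (m ^ 2) // ρ ^ (2 + 1) = 1} : ℝ) ≤ 1 * 3 ^ m.primeFactors.card := by
    intro m hm
    have h := SquarefulCount.natCard_cubeRootsOfUnity_le (m ^ 2) (by positivity)
    rw [Nat.primeFactors_pow m two_ne_zero] at h
    rw [one_mul]
    exact_mod_cast h
  have hGswap : ∀ q' ∈ G.image Prod.swap, (∀ i, q'.1 i < 2 * Y i) ∧
      (∀ i, X i ≤ q'.2 i ∧ q'.2 i < 2 * X i) ∧ (∀ i, q'.2 i ≤ B) ∧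
      (∀ i j, i ≠ j → Nat.Coprime (q'.1 i * q'.2 i) (q'.1 j * q'.2 j)) ∧
      (q'.2 0 : ℤ) ^ 2 * (q'.1 0 : ℤ) ^ (2 + 1) + (q'.2 1 : ℤ) ^ 2 * (q'.1 1 : ℤ) ^ (2 + 1)
        = (q'.2 2 : ℤ) ^ 2 * (q'.1 2 : ℤ) ^ (2 + 1) := by
    intro q' hq'
    obtain ⟨q, hq, rfl⟩ := Finset.mem_image.mp hq'
    obtain ⟨hx, hy, hxB, -, hcop, heq, -⟩ := hG q hq
    refine ⟨fun i => (hy i).2, hx, hxB, fun i j hij => ?_, ?_⟩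
    · simpa only [Prod.fst_swap, Prod.snd_swap, mul_comm] using hcop i j hij
    · simp only [Prod.fst_swap, Prod.snd_swap]
      linear_combination heq
  have hcubic := (viewBound (n := 2) (e := 2) (t := 2) (by norm_num) (by norm_num) 1 3
    (by norm_num) hroot3 SquarefulCount.sum_three_pow_omega_le hN₀ hprime B Y X hX hXB
    (G.image Prod.swap) hGswap)
  rw [Finset.card_image_of_injective _ Prod.swap_injective] at hcubic
  set s : ℝ := (48 * Yp / Xp ^ 2) ^ (1 / 3 : ℝ) with hs
  have hs3 : s ^ 3 * Xp ^ 2 = 48 * Yp := by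
    have : s ^ 3 = 48 * Yp / Xp ^ 2 := by
      rw [hs, ← Real.rpow_natCast, ← Real.rpow_mul (by positivity)]; norm_num
    rw [this, div_mul_cancel₀ _ (by positivity)]
  have h2 : (#G : ℝ) ≤ 1152 * (Λ + s) * (Xp * Λ ^ 6) := by
    refine hcubic.trans ?_
    have hfac : (96 : ℝ) * (((2 : ℕ) : ℝ) + 1) * (((2 : ℕ) : ℝ) + 2) * (1 : ℝ) ^ 3 = 1152 := by
      norm_num
    rw [hfac]
    have hs0 : 0 ≤ s := Real.rpow_nonneg (by positivity) _
    have hΛs : N₀ + 2 * Real.log (6 * (B : ℝ) ^ 3) + s ≤ Λ + s := by linarith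
    have hpos : 0 ≤ N₀ + 2 * Real.log (6 * (B : ℝ) ^ 3) + s := by
      have : (6 * (B : ℝ) ^ 3) = ((6 * B ^ 3 : ℕ) : ℝ) := by push_cast; ring
      have hl : 0 ≤ Real.log (6 * (B : ℝ) ^ 3) := by rw [this]; exact Real.log_natCast_nonneg _
      linarith
    have hpow : (1 + Real.log (2 * (B : ℝ))) ^ (3 * 2) ≤ Λ ^ 6 := pow_le_pow_left₀ hlog2B hΛb 6
    exact mul_le_mul (mul_le_mul_of_nonneg_left hΛs (by norm_num))
      (mul_le_mul_of_nonneg_left hpow hXp0.le) (by positivity) (by positivity)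
  have := optimise hXp1 hYp1 hΛ1 hβ hβ5 hβ6 (by norm_num) (by norm_num) hXY hr3 hs3 h1 h2
  linarith

/-! ### Theorem 2 -/

/-- The decomposition of a positive squareful number as a pair `(x, y)`, `a = x² y³`.
[folklore] -/
theorem exists_pair_sq_mul_cube {a : ℕ} (ha : 0 < a) (hpow : IsPowerful 2 a) :
    ∃ q : ℕ × ℕ, 0 < q.1 ∧ 0 < q.2 ∧ a = q.1 ^ 2 * q.2 ^ 3 := by
  obtain ⟨x, y, hx, hy, h⟩ := exists_sq_mul_cube_of_isPowerful ha hpow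
  exact ⟨(x, y), hx, hy, h⟩

end SquarefulUpper

open Finset SquarefulUpper in
/-- **Browning–Van Valckenborgh 2012, Theorem 2** (discharge of the named fact
`SquarefulSumUpperBound`): `N₁(B) ≤ C · B^{3/5} (log B)^{12}` for all `B ≥ 2`.

Proof (§4 of the paper, with its Lemma 3 replaced by the elementary determinant method of
`SquarefulDet.fiberBound`): write the three squareful numbers as `xᵢ² yᵢ³`, split into
`≪ (log B)⁶` dyadic boxes, and bound each box by `boxBound` (`≪ B^{3/5} (log B)⁶`).
[cite: BrowningValckenborgh2012, Thm. 2] -/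
theorem SquarefulSumUpperBound_holds : SquarefulSumUpperBound := by
  classical
  obtain ⟨N₀, hN₀, hprime⟩ := SquarefulCount.exists_prime_Ioc_not_dvd
  set M : ℝ := N₀ / Real.log 2 + 12 with hM
  refine ⟨28800 * 729 * M ^ 6, fun B hB => ?_⟩
  -- constants
  have hB1 : 1 ≤ B := by omega
  have hB1r : (1 : ℝ) ≤ B := by exact_mod_cast hB1
  have hB0r : (0 : ℝ) ≤ B := by linarith
  have hlog2 : (0.6931471803 : ℝ) < Real.log 2 := Real.log_two_gt_d9
  set ℓ : ℝ := Real.log B with hℓ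
  have hℓ2 : Real.log 2 ≤ ℓ := Real.log_le_log two_pos (by exact_mod_cast hB)
  have hℓ0 : 0 < ℓ := by linarith
  have hM0 : 0 ≤ N₀ / Real.log 2 := by positivity
  have hM12 : 12 ≤ M := by rw [hM]; linarith
  set Λ : ℝ := M * ℓ with hΛ
  have hΛ1 : 1 ≤ Λ := by rw [hΛ]; nlinarith
  have hN₀ℓ : N₀ ≤ N₀ / Real.log 2 * ℓ := by
    rw [div_mul_eq_mul_div, le_div_iff₀ (by linarith)]
    exact mul_le_mul_of_nonneg_left hℓ2 hN₀.le
  have hΛa : N₀ + 2 * Real.log (6 * (B : ℝ) ^ 3) ≤ Λ := by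
    rw [Real.log_mul (by norm_num) (by positivity), Real.log_pow, Nat.cast_ofNat]
    have hlog6 : Real.log 6 < 2 := by
      have he := Real.exp_one_gt_d9
      have h6 : (6 : ℝ) < Real.exp 2 := by
        rw [show (2 : ℝ) = 1 + 1 by norm_num, Real.exp_add]; nlinarith
      have := Real.log_lt_log (by norm_num) h6
      rwa [Real.log_exp] at this
    calc N₀ + 2 * (Real.log 6 + 3 * ℓ) ≤ N₀ / Real.log 2 * ℓ + 12 * ℓ := by nlinarith
      _ = Λ := by rw [hΛ, hM]; ring
  have hΛb : 1 + Real.log (2 * B) ≤ Λ := by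
    rw [Real.log_mul two_ne_zero (by positivity)]
    calc 1 + (Real.log 2 + ℓ) ≤ 12 * ℓ := by nlinarith
      _ ≤ M * ℓ := by gcongr
      _ = Λ := by rw [hΛ]
  set β : ℝ := (B : ℝ) ^ (3 / 5 : ℝ) with hβ
  have hβ1 : 1 ≤ β := Real.one_le_rpow hB1r (by norm_num)
  have hβ5 : β ^ 5 = (B : ℝ) ^ 3 := by
    rw [hβ, ← Real.rpow_natCast, ← Real.rpow_mul hB0r]
    rw [show (3 / 5 : ℝ) * ((5 : ℕ) : ℝ) = ((3 : ℕ) : ℝ) by norm_num, Real.rpow_natCast]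
  have hβ6 : (B : ℝ) ^ 3 ≤ β ^ 6 := by
    rw [hβ, ← Real.rpow_natCast ((B : ℝ) ^ (3 / 5 : ℝ)) 6, ← Real.rpow_mul hB0r]
    calc (B : ℝ) ^ 3 = (B : ℝ) ^ ((3 : ℕ) : ℝ) := (Real.rpow_natCast (B : ℝ) 3).symm
      _ ≤ (B : ℝ) ^ ((3 / 5 : ℝ) * ((6 : ℕ) : ℝ)) :=
          Real.rpow_le_rpow_of_exponent_le hB1r (by norm_num)
  -- Step 1: the parameter set
  set T : Finset ((Fin 3 → ℕ) × (Fin 3 → ℕ)) :=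
    ((Fintype.piFinset fun _ : Fin 3 => Finset.Icc 1 B) ×ˢ
      (Fintype.piFinset fun _ : Fin 3 => Finset.Icc 1 B)).filter fun q =>
      (∀ i j, i ≠ j → Nat.Coprime (q.1 i * q.2 i) (q.1 j * q.2 j)) ∧
      (q.2 0 : ℤ) ^ 3 * (q.1 0 : ℤ) ^ 2 + (q.2 1 : ℤ) ^ 3 * (q.1 1 : ℤ) ^ 2
        = (q.2 2 : ℤ) ^ 3 * (q.1 2 : ℤ) ^ 2 ∧ q.1 2 ^ 2 * q.2 2 ^ 3 ≤ B with hT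
  have hmemT : ∀ q, q ∈ T ↔ ((∀ i, 1 ≤ q.1 i ∧ q.1 i ≤ B) ∧ (∀ i, 1 ≤ q.2 i ∧ q.2 i ≤ B)) ∧
      (∀ i j, i ≠ j → Nat.Coprime (q.1 i * q.2 i) (q.1 j * q.2 j)) ∧
      (q.2 0 : ℤ) ^ 3 * (q.1 0 : ℤ) ^ 2 + (q.2 1 : ℤ) ^ 3 * (q.1 1 : ℤ) ^ 2
        = (q.2 2 : ℤ) ^ 3 * (q.1 2 : ℤ) ^ 2 ∧ q.1 2 ^ 2 * q.2 2 ^ 3 ≤ B := by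
    intro q
    simp only [hT, Finset.mem_filter, Finset.mem_product, Fintype.mem_piFinset, Finset.mem_Icc]
  have hcountT : squarefulSumCount B ≤ #T := by
    let dec : ℕ → ℕ × ℕ := fun a =>
      if h : 0 < a ∧ IsPowerful 2 a then Classical.choose (exists_pair_sq_mul_cube h.1 h.2)
      else (0, 0)
    have hdec : ∀ a, 0 < a → IsPowerful 2 a →
        0 < (dec a).1 ∧ 0 < (dec a).2 ∧ a = (dec a).1 ^ 2 * (dec a).2 ^ 3 := by
      intro a ha hp
      have h : 0 < a ∧ IsPowerful 2 a := ⟨ha, hp⟩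
      simp only [dec, h]
      exact Classical.choose_spec (exists_pair_sq_mul_cube h.1 h.2)
    let g : ℕ × ℕ × ℕ → (Fin 3 → ℕ) × (Fin 3 → ℕ) := fun t =>
      (![(dec t.1).1, (dec t.2.1).1, (dec t.2.2).1], ![(dec t.1).2, (dec t.2.1).2, (dec t.2.2).2])
    rw [squarefulSumCount, ← Set.ncard_coe_finset T]
    refine Set.ncard_le_ncard_of_injOn g (fun t ht => ?_) (fun t ht t' ht' h => ?_)
      (Finset.finite_toSet T)
    · rw [mem_squarefulSumTriples_iff] at ht
      obtain ⟨⟨ha, hb, habc, hab⟩, hcB, hpa, hpb, hpc⟩ := ht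
      have hc : 0 < t.2.2 := by omega
      obtain ⟨hx0, hy0, he0⟩ := hdec _ ha hpa
      obtain ⟨hx1, hy1, he1⟩ := hdec _ hb hpb
      obtain ⟨hx2, hy2, he2⟩ := hdec _ hc hpc
      have hac : t.1.Coprime t.2.2 := by rw [← habc]; exact Nat.coprime_self_add_right.2 hab
      have hbc : t.2.1.Coprime t.2.2 := by rw [← habc]; exact Nat.coprime_add_self_right.2 hab.symm
      -- sizes
      have hle : ∀ {a x y : ℕ}, 0 < x → 0 < y → a = x ^ 2 * y ^ 3 → x ≤ a ∧ y ≤ a := by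
        intro a x y hx hy he
        subst he
        constructor
        · calc x = x * 1 := (mul_one x).symm
            _ ≤ x ^ 2 * y ^ 3 := by
              rw [pow_two, mul_assoc]
              exact Nat.mul_le_mul_left x (Nat.one_le_iff_ne_zero.mpr (by positivity))
        · calc y = 1 * y := (one_mul y).symm
            _ ≤ x ^ 2 * y ^ 3 := by
              rw [pow_succ y 2, ← mul_assoc]
              exact Nat.mul_le_mul_right y (Nat.one_le_iff_ne_zero.mpr (by positivity))
      have hdvd : ∀ {a x y : ℕ}, a = x ^ 2 * y ^ 3 → x * y ∣ a := by
        intro a x y he; exact ⟨x * y ^ 2, by rw [he]; ring⟩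
      have haB : t.1 ≤ B := by omega
      have hbB : t.2.1 ≤ B := by omega
      rw [Finset.mem_coe, hmemT]
      refine ⟨⟨?_, ?_⟩, ?_, ?_, ?_⟩
      · intro i
        fin_cases i
        · exact ⟨hx0, (hle hx0 hy0 he0).1.trans haB⟩
        · exact ⟨hx1, (hle hx1 hy1 he1).1.trans hbB⟩
        · exact ⟨hx2, (hle hx2 hy2 he2).1.trans hcB⟩
      · intro i
        fin_cases i
        · exact ⟨hy0, (hle hx0 hy0 he0).2.trans haB⟩
        · exact ⟨hy1, (hle hx1 hy1 he1).2.trans hbB⟩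
        · exact ⟨hy2, (hle hx2 hy2 he2).2.trans hcB⟩
      · intro i j hij
        have h01 : Nat.Coprime ((dec t.1).1 * (dec t.1).2) ((dec t.2.1).1 * (dec t.2.1).2) :=
          (hab.coprime_dvd_left (hdvd he0)).coprime_dvd_right (hdvd he1)
        have h02 : Nat.Coprime ((dec t.1).1 * (dec t.1).2) ((dec t.2.2).1 * (dec t.2.2).2) :=
          (hac.coprime_dvd_left (hdvd he0)).coprime_dvd_right (hdvd he2)
        have h12 : Nat.Coprime ((dec t.2.1).1 * (dec t.2.1).2) ((dec t.2.2).1 * (dec t.2.2).2) :=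
          (hbc.coprime_dvd_left (hdvd he1)).coprime_dvd_right (hdvd he2)
        fin_cases i <;> fin_cases j
        · exact absurd rfl hij
        · exact h01
        · exact h02
        · exact h01.symm
        · exact absurd rfl hij
        · exact h12
        · exact h02.symm
        · exact h12.symm
        · exact absurd rfl hij
      · have h := habc
        rw [he0, he1, he2] at h
        have h' : (((dec t.1).1 ^ 2 * (dec t.1).2 ^ 3 + (dec t.2.1).1 ^ 2 * (dec t.2.1).2 ^ 3 : ℕ) : ℤ)
            = (((dec t.2.2).1 ^ 2 * (dec t.2.2).2 ^ 3 : ℕ) : ℤ) := by exact_mod_cast h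
        push_cast at h'
        change ((dec t.1).2 : ℤ) ^ 3 * ((dec t.1).1 : ℤ) ^ 2 + ((dec t.2.1).2 : ℤ) ^ 3 * ((dec t.2.1).1 : ℤ) ^ 2
          = ((dec t.2.2).2 : ℤ) ^ 3 * ((dec t.2.2).1 : ℤ) ^ 2
        linear_combination h'
      · change (dec t.2.2).1 ^ 2 * (dec t.2.2).2 ^ 3 ≤ B
        rw [← he2]; exact hcB
    · -- injectivity: the triple is recovered from its decomposition
      rw [mem_squarefulSumTriples_iff] at ht ht'
      obtain ⟨⟨ha, hb, habc, -⟩, -, hpa, hpb, hpc⟩ := ht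
      obtain ⟨⟨ha', hb', habc', -⟩, -, hpa', hpb', hpc'⟩ := ht'
      have hc : 0 < t.2.2 := by omega
      have hc' : 0 < t'.2.2 := by omega
      simp only [g, Prod.mk.injEq] at h
      obtain ⟨h1, h2⟩ := h
      have e10 := congrFun h1 0; have e11 := congrFun h1 1; have e12 := congrFun h1 2
      have e20 := congrFun h2 0; have e21 := congrFun h2 1; have e22 := congrFun h2 2
      simp only [Matrix.cons_val_zero, Matrix.cons_val_one, Matrix.cons_val_two, Matrix.head_cons,
        Matrix.tail_cons] at e10 e11 e12 e20 e21 e22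
      have k0 := (hdec _ ha hpa).2.2; have k0' := (hdec _ ha' hpa').2.2
      have k1 := (hdec _ hb hpb).2.2; have k1' := (hdec _ hb' hpb').2.2
      have k2 := (hdec _ hc hpc).2.2; have k2' := (hdec _ hc' hpc').2.2
      refine Prod.ext ?_ (Prod.ext ?_ ?_)
      · rw [k0, k0', e10, e20]
      · rw [k1, k1', e11, e21]
      · rw [k2, k2', e12, e22]
  -- Step 2: dyadic boxes
  set Lb := Nat.log 2 B with hLb
  set boxes := (Fintype.piFinset fun _ : Fin 3 => Finset.range (Lb + 1)) ×ˢ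
    (Fintype.piFinset fun _ : Fin 3 => Finset.range (Lb + 1)) with hboxes
  let bx : (Fin 3 → ℕ) × (Fin 3 → ℕ) → (Fin 3 → ℕ) × (Fin 3 → ℕ) := fun q =>
    (fun i => Nat.log 2 (q.1 i), fun i => Nat.log 2 (q.2 i))
  have hbx : ∀ q ∈ T, bx q ∈ boxes := by
    intro q hq
    rw [hmemT] at hq
    simp only [hboxes, Finset.mem_product, Fintype.mem_piFinset, Finset.mem_range, bx]
    exact ⟨fun i => Nat.lt_succ_of_le (Nat.log_mono_right (hq.1.1 i).2),
      fun i => Nat.lt_succ_of_le (Nat.log_mono_right (hq.1.2 i).2)⟩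
  have hTsum : #T = ∑ b ∈ boxes, #{q ∈ T | bx q = b} := Finset.card_eq_sum_card_fiberwise hbx
  have hpowB : 2 ^ Lb ≤ B := Nat.pow_log_le_self 2 (by omega)
  have hfib : ∀ b ∈ boxes, (#{q ∈ T | bx q = b} : ℝ) ≤ 28800 * β * Λ ^ 6 := by
    intro b hb
    simp only [hboxes, Finset.mem_product, Fintype.mem_piFinset, Finset.mem_range] at hb
    have hXB : ∀ i, 2 ^ b.1 i ≤ B := fun i =>
      (Nat.pow_le_pow_right two_pos (Nat.le_of_lt_succ (hb.1 i))).trans hpowB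
    have hYB : ∀ i, 2 ^ b.2 i ≤ B := fun i =>
      (Nat.pow_le_pow_right two_pos (Nat.le_of_lt_succ (hb.2 i))).trans hpowB
    refine boxBound hN₀ hprime B (fun i => 2 ^ b.1 i) (fun i => 2 ^ b.2 i)
      (fun i => by positivity) (fun i => by positivity) hXB hYB Λ β hΛ1 hΛa hΛb hβ1 hβ5 hβ6 _ ?_
    intro q hq
    rw [Finset.mem_filter, hmemT] at hq
    obtain ⟨⟨⟨hx, hy⟩, hcop, heq, hle⟩, hbq⟩ := hq
    have hb1 : (fun i => Nat.log 2 (q.1 i)) = b.1 := congrArg Prod.fst hbq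
    have hb2 : (fun i => Nat.log 2 (q.2 i)) = b.2 := congrArg Prod.snd hbq
    refine ⟨fun i => ?_, fun i => ?_, fun i => (hx i).2, fun i => (hy i).2, hcop, heq, hle⟩
    · have h : Nat.log 2 (q.1 i) = b.1 i := congrFun hb1 i
      rw [← h]
      exact ⟨Nat.pow_log_le_self 2 (by have := (hx i).1; omega),
        by rw [← pow_succ']; exact Nat.lt_pow_succ_log_self one_lt_two _⟩
    · have h : Nat.log 2 (q.2 i) = b.2 i := congrFun hb2 i
      rw [← h]
      exact ⟨Nat.pow_log_le_self 2 (by have := (hy i).1; omega),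
        by rw [← pow_succ']; exact Nat.lt_pow_succ_log_self one_lt_two _⟩
  -- Step 3: adding up
  have hboxcard : (#boxes : ℝ) = ((Lb : ℝ) + 1) ^ 6 := by
    rw [hboxes, Finset.card_product, Fintype.card_piFinset]
    simp only [Finset.card_range, Finset.prod_const, Finset.card_univ, Fintype.card_fin]
    push_cast; ring
  have hLbℓ : (Lb : ℝ) + 1 ≤ 3 * ℓ := by
    have h1 : (2 : ℝ) ^ Lb ≤ B := by exact_mod_cast hpowB
    have h2 : (Lb : ℝ) * Real.log 2 ≤ ℓ := by
      rw [← Real.log_pow]; exact Real.log_le_log (by positivity) h1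
    nlinarith
  calc (squarefulSumCount B : ℝ) ≤ #T := by exact_mod_cast hcountT
    _ = ∑ b ∈ boxes, (#{q ∈ T | bx q = b} : ℝ) := by rw [hTsum]; push_cast; rfl
    _ ≤ ∑ b ∈ boxes, 28800 * β * Λ ^ 6 := Finset.sum_le_sum hfib
    _ = ((Lb : ℝ) + 1) ^ 6 * (28800 * β * Λ ^ 6) := by
        rw [Finset.sum_const, nsmul_eq_mul, hboxcard]
    _ ≤ (3 * ℓ) ^ 6 * (28800 * β * Λ ^ 6) := by gcongr
    _ = 28800 * 729 * M ^ 6 * β * ℓ ^ 12 := by rw [hΛ]; ring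
    _ = 28800 * 729 * M ^ 6 * (B : ℝ) ^ (3 / 5 : ℝ) * Real.log B ^ 12 := by rw [hβ, hℓ]

end Literature.NumberTheory.DiophantineGeometry
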